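import Summits.ResolutionOfSingularities.ResolutionOfSingularities.Theorems.PurelyInseparableDim4ChartClosureIdeal
import Summits.ResolutionOfSingularities.ResolutionOfSingularities.Theorems.PurelyInseparableDim4CentreAdmissible
import Summits.ResolutionOfSingularities.ResolutionOfSingularities.Theorems.Rescue.ResIdeaFrameIndepZ
import Literature.Barriers.ResolutionOfSingularities.ResidualOrderUnboundedBlowup
import HarnessLib

/-!
# Purely inseparable four-folds `z^p + F(x₁, …, x₄)`: the escaping global centre READ ON THE OTHER CHARTS —
# ring level (brick S3-N1 «atlas of an escaping global centre», part E1; cell `res-dim4-pi`, typ-2 g5)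

[OURS · counted 0] (D-0157 DOOR 2; DR-157-C; desk WORD #115 (a) (S3-N1): «the MULTI-CHART MEMBER FORMAT … cover
of `Zc` by the charts `W[⊤, x_λ]`, `λ ∈ Λ_S ∖ Λ_{S'}`»; typ-3 g4 `S3c-V3-DESIGN.md`: «typ-2 supplies chart facts by
signature»; frame `PIDim4.TerminationImpliesOrderReduction`, S3 (c)). Setting of `…ChartClosureIdeal` (A2) /
`…ChartClosureStrict` (B2): `j ∈ S`, `j ∉ S'`, the graph `Y = V(J_Y) ⊂ 𝔸⁵`,
`J_Y = (z − H, x_k − b_k (k ∈ S' ∖ S), xᵢ − bᵢ x_j (i ∈ S' ∩ S))` with `H ∈ (xᵢ : i ∈ S)`, whose strict transform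
under ANY blowing up of `𝔸⁵` along `V(z, x_S)` is the global centre `Zc` of the (possibly ESCAPING) next coordinate
centre (B2 `strictTransformIdeal_graph_eq_globalCentre`). A2 read `Zc` on the `x_j`-chart. THIS FILE reads it on the
`x_l`-chart for every OTHER centre variable `l ∈ S ∖ S'`, `l ≠ j` — the charts that, together with the `x_j`-chart,
COVER `Zc` (sequel E3). The re-centring of the `x_l`-chart is no longer a translation: it is a SHEAR
`Θ` (`Θ z = z + g(x)`, `Θ x = τ x` with `τ x_l = x_l`, `τ x_j = x_j`, `τ xᵢ = xᵢ + bᵢ x_j` (`i ∈ S' ∩ S`),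
`τ x_k = x_k + b_k` (`k ∈ S' ∖ S`), and `g ≡ τ H_l (mod x_{S'})` where `ψ_{S,l}(H) = x_l · H_l`).
PROVED here (no `sorry`, no new axiom), all at the level of the polynomial ring `K[z, x]`:

* §1 `exists_coordBlowupSubst_eq_X_mul_of_mem_span` (`H ∈ (x_S) ⇒ ψ_{S,l} H = x_l H_l`),
  `coordBlowupSubst_X_sub_C_mul_of_ne` (`ψ_l(xᵢ − bᵢ x_j) = x_l (xᵢ − bᵢ x_j)`, `i, j ∈ S ∖ l`);
* §2 `shear_rename`, `shear_X_succ_of_eq`, `shear_hyp` (`Θ(z^p + G) = z^p + (g^p + τ G)`),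
  **`shear_coordBlowupSubst_hyp`**: `Θ(ψ_l(z^p + F)) = x_l^p · (z^p + (g^p + τ F'_l))`, `F'_l = chartTransform p S l F`
  — THE TRANSFORM READ ON THE RE-CENTRED `x_l`-CHART;
* §3 **`map_shear_coordStrictTransformIdeal_graph`**: `Θ (J_Y^{st,l}) = (z, x_{S'})` — ON THE RE-CENTRED
  `x_l`-CHART THE STRICT TRANSFORM OF `Y` (= the global centre `Zc`) IS AGAIN THE COORDINATE SUBSPACE
  `V(z, x_{S'})`, with the SAME `S'`;
* §4 `ordAlong_le_ordAlong_deletePthPowers`, `deletePthPowers_pow_add`,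
  **`exists_clean_add_pow_mem_span`**: if `p ≤ ord_{(x_{S'})} G` then the CLEANING root `h` of `G`
  (`G + h^p = deletePthPowers p G`) lies in `(x_k : k ∈ S')` — so cleaning the reading `z ↦ z + h` keeps the centre
  `V(z, x_{S'})` in place (`g := τ H_l + h` still satisfies `g ≡ τ H_l`), and the cleaned reading is still permissible.

HONEST SCOPE: ring identities only; the existence of the shear as a `K`-automorphism, the sheaf-level readings and the
cover are the sequels E1b/E2/E3. Nothing here is a statement about resolution of singularities in dimension ≥ 4 / characteristic `p`
(NOT proved anywhere in this programme). bears_on: LADDER-RESOLUTION:D157-DOOR2 (res-dim4-pi). Supports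
stmt-ResolutionOfSingularities-16155 (helper, S3-N1 E1).
-/

-- every declaration of this summit lives under `Summit.ResolutionOfSingularities.ResolutionOfSingularities`
-- (summit = problem), which the duplicate-namespace linter flags; house convention (cf. the Target file).
set_option linter.dupNamespace false

noncomputable section

open MvPolynomial Finset

open scoped BigOperators

namespace Summit.ResolutionOfSingularities.ResolutionOfSingularities.Theorems.PIDim4

open Literature.AlgebraicGeometry.Resolution
open Literature.AlgebraicGeometry.Resolution.Hauser2010
open Literature.AlgebraicGeometry.Resolution.AffinePointBlowup (A)
open Literature.RingTheory.MvPolynomial (ker_aeval_ite_eq_span isPrime_span_X_image X_mem_span_X_image_iff)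
open Literature.Barriers.ResolutionOfSingularities

namespace ChartDictionary

variable {K : Type} [Field K] {p : ℕ} {S S' : Finset (Fin 4)} {j l : Fin 4} {b : Fin 4 → K}
  {Θ : A 4 K ≃ₐ[K] A 4 K} {τ : MvPolynomial (Fin 4) K ≃ₐ[K] MvPolynomial (Fin 4) K}
  {g : MvPolynomial (Fin 4) K} {F : MvPolynomial (Fin 4) K}

/-! ## §1 The `x_l`-chart substitution on the graph generators -/

/-- A polynomial of the ideal `(xᵢ : i ∈ S)` is divisible by `x_l` after the `x_l`-chart substitution
(`l ∈ S`): `ψ_{S,l}(H) = x_l · H_l` (the tree's `map_coordBlowupSubst_span_eq`: `ψ_{S,l}((x_S)) = (x_l)`). -/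
theorem exists_coordBlowupSubst_eq_X_mul_of_mem_span (hl : l ∈ S) {H : MvPolynomial (Fin 4) K}
    (hH : H ∈ Ideal.span (X '' (S : Set (Fin 4)) : Set (MvPolynomial (Fin 4) K))) :
    ∃ Hl : MvPolynomial (Fin 4) K, coordBlowupSubst K (S : Set (Fin 4)) l H = X l * Hl := by
  have h1 : coordBlowupSubst K (S : Set (Fin 4)) l H ∈
      (Ideal.span (X '' (S : Set (Fin 4)) : Set (MvPolynomial (Fin 4) K))).map
        (coordBlowupSubst K (S : Set (Fin 4)) l) := Ideal.mem_map_of_mem _ hH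
  rw [map_coordBlowupSubst_span_eq K (S : Set (Fin 4)) l (Finset.mem_coe.mpr hl),
    Ideal.mem_span_singleton'] at h1
  obtain ⟨a, ha⟩ := h1
  exact ⟨a, by rw [← ha, mul_comm]⟩

/-- On the `x_l`-chart: `ψ_l(xᵢ − bᵢ x_j) = x_l · (xᵢ − bᵢ x_j)` for centre variables `i, j ∈ S` other than `l`. -/
theorem coordBlowupSubst_X_sub_C_mul_of_ne (hj : j ∈ S) (hjl : j ≠ l) {i : Fin 4} (hi : i ∈ S) (hil : i ≠ l) :
    coordBlowupSubst K (insert 0 (Fin.succ '' (S : Set (Fin 4)))) l.succ (X i.succ - C (b i) * X j.succ : A 4 K) =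
      X l.succ * (X i.succ - C (b i) * X j.succ) := by
  rw [map_sub, map_mul, coordBlowupSubst_C,
    coordBlowupSubst_X_of_mem_of_ne K _ l.succ (succ_mem_centreVars hi) (fun e => hil (Fin.succ_inj.mp e)),
    coordBlowupSubst_X_of_mem_of_ne K _ l.succ (succ_mem_centreVars hj) (fun e => hjl (Fin.succ_inj.mp e))]
  ring

/-! ## §2 The shear re-centring `Θ` of the `x_l`-chart: `Θ z = z + g(x)`, `Θ|_{K[x]} = τ` -/

/-- `Θ` acts on polynomials in `x` through `τ`. -/
theorem shear_rename (hτ : ∀ i : Fin 4, Θ (X i.succ) = rename Fin.succ (τ (X i))) (G : MvPolynomial (Fin 4) K) :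
    Θ (rename Fin.succ G) = rename Fin.succ (τ G) := by
  have hc : (Θ : A 4 K →ₐ[K] A 4 K).comp (rename Fin.succ) =
      (rename Fin.succ).comp (τ : MvPolynomial (Fin 4) K →ₐ[K] MvPolynomial (Fin 4) K) := by
    refine MvPolynomial.algHom_ext fun k => ?_
    rw [AlgHom.comp_apply, AlgHom.comp_apply, rename_X, AlgEquiv.coe_toAlgHom, AlgEquiv.coe_toAlgHom, hτ k]
  exact congrArg (fun f : MvPolynomial (Fin 4) K →ₐ[K] A 4 K => f G) hc

/-- A variable fixed by `τ` is fixed by `Θ`. -/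
theorem shear_X_succ_of_eq (hτ : ∀ i : Fin 4, Θ (X i.succ) = rename Fin.succ (τ (X i))) {i : Fin 4}
    (hτi : τ (X i) = X i) : Θ (X i.succ) = X i.succ := by
  rw [hτ i, hτi, rename_X]

/-- **`Θ (z^p + G) = z^p + (g^p + τ G)`** in characteristic `p`. -/
theorem shear_hyp [hp : Fact p.Prime] [CharP K p] (h0 : Θ (X 0) = X 0 + rename Fin.succ g)
    (hτ : ∀ i : Fin 4, Θ (X i.succ) = rename Fin.succ (τ (X i))) (G : MvPolynomial (Fin 4) K) :
    Θ (hyp p G) = hyp p (g ^ p + τ G) := by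
  rw [hyp, hyp, map_add, map_pow, h0, shear_rename hτ, add_pow_char, map_add, map_pow, add_assoc]

/-- **THE TRANSFORM READ ON THE RE-CENTRED `x_l`-CHART.** For `l ∈ S`, `p ≤ ord_{(x_S)} F` and a shear `Θ` fixing
`x_l`: `Θ(ψ_l(z^p + F)) = x_l^p · (z^p + (g^p + τ F'_l))`, `F'_l = chartTransform p S l F`. -/
theorem shear_coordBlowupSubst_hyp [Fact p.Prime] [CharP K p] (hl : l ∈ S) (h0 : Θ (X 0) = X 0 + rename Fin.succ g)
    (hτ : ∀ i : Fin 4, Θ (X i.succ) = rename Fin.succ (τ (X i))) (hτl : τ (X l) = X l)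
    (hperm : (p : ℕ∞) ≤ CentreBlowup.ordAlong S F) :
    Θ (coordBlowupSubst K (insert 0 (Fin.succ '' (S : Set (Fin 4)))) l.succ (hyp p F)) =
      X l.succ ^ p * hyp p (g ^ p + τ (CentreBlowup.chartTransform p S l F)) := by
  rw [coordBlowupSubst_hyp p hl F hperm, map_mul, map_pow, shear_X_succ_of_eq hτ hτl, shear_hyp h0 hτ]

/-- `Θ (x_k − b_k) = x_k` when `τ x_k = x_k + b_k`. -/
theorem shear_X_sub_C (hτ : ∀ i : Fin 4, Θ (X i.succ) = rename Fin.succ (τ (X i))) {k : Fin 4}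
    (hτk : τ (X k) = X k + C (b k)) : Θ (X k.succ - C (b k) : A 4 K) = X k.succ := by
  have hC : Θ (C (b k)) = C (b k) := Θ.commutes (b k)
  rw [map_sub, hτ k, hτk, map_add, rename_X, rename_C, hC, add_sub_cancel_right]

/-- `Θ (xᵢ − bᵢ x_j) = xᵢ` when `τ xᵢ = xᵢ + bᵢ x_j` and `τ x_j = x_j`. -/
theorem shear_X_sub_C_mul (hτ : ∀ i : Fin 4, Θ (X i.succ) = rename Fin.succ (τ (X i))) (hτj : τ (X j) = X j)
    {i : Fin 4} (hτi : τ (X i) = X i + C (b i) * X j) :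
    Θ (X i.succ - C (b i) * X j.succ : A 4 K) = X i.succ := by
  have hC : Θ (C (b i)) = C (b i) := Θ.commutes (b i)
  rw [map_sub, map_mul, hC, shear_X_succ_of_eq hτ hτj, hτ i, hτi, map_add, map_mul, rename_X, rename_C, rename_X,
    add_sub_cancel_right]

/-- `Θ (z − H_l) = z + (g − τ H_l)`. -/
theorem shear_X_zero_sub (h0 : Θ (X 0) = X 0 + rename Fin.succ g)
    (hτ : ∀ i : Fin 4, Θ (X i.succ) = rename Fin.succ (τ (X i))) (Hl : MvPolynomial (Fin 4) K) :
    Θ (X 0 - rename Fin.succ Hl) = X 0 + rename Fin.succ (g - τ Hl) := by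
  rw [map_sub, h0, shear_rename hτ, map_sub]
  ring

/-- A polynomial of `(x_k : k ∈ S')`, renamed into `K[z, x]`, lies in `(z, x_{S'})`. -/
theorem rename_mem_IΛ_of_mem_span {P : MvPolynomial (Fin 4) K}
    (hP : P ∈ Ideal.span (X '' (S' : Set (Fin 4)) : Set (MvPolynomial (Fin 4) K))) :
    rename Fin.succ P ∈ AffineCoordBlowup.IΛ 4 K (insert 0 (Fin.succ '' (S' : Set (Fin 4)))) := by
  have h4 := Ideal.mem_map_of_mem (rename Fin.succ : MvPolynomial (Fin 4) K →ₐ[K] A 4 K).toRingHom hP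
  rw [Ideal.map_span] at h4
  refine (Ideal.span_le.mpr ?_) h4
  rintro _ ⟨_, ⟨i, hi, rfl⟩, rfl⟩
  exact Ideal.subset_span ⟨i.succ, Set.mem_insert_of_mem _ ⟨i, hi, rfl⟩,
    by rw [AlgHom.toRingHom_eq_coe, RingHom.coe_coe, rename_X]⟩

/-! ## §3 The strict transform of the graph on the re-centred `x_l`-chart -/

/-- **THE STRICT TRANSFORM OF THE GRAPH, READ ON THE RE-CENTRED `x_l`-CHART, IS THE NEXT CENTRE** (`l ∈ S ∖ S'`,
`l ≠ j`, `j ∈ S ∖ S'`). Let `J_Y = (z − H, x_k − b_k (k ∈ S' ∖ S), xᵢ − bᵢ x_j (i ∈ S' ∩ S))` with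
`ψ_{S,l}(H) = x_l · H_l`, and `Θ` a shear re-centring of the `x_l`-chart: `Θ z = z + g`, `Θ|_{K[x]} = τ`,
`τ x_l = x_l`, `τ x_j = x_j`, `τ xᵢ = xᵢ + bᵢ x_j` (`i ∈ S' ∩ S`), `τ x_k = x_k + b_k` (`k ∈ S' ∖ S`),
`g ≡ τ H_l (mod (x_k : k ∈ S'))`. Then `Θ` carries the `x_l`-saturation `J_Y^{st,l} = ⋃ₙ (ψ_l(J_Y) : x_lⁿ)` (the
tree's `coordStrictTransformIdeal`, the ideal of the strict transform on the chart) onto `(z, x_{S'})`. -/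
theorem map_shear_coordStrictTransformIdeal_graph (hj : j ∈ S) (hlS' : l ∉ S') (hjl : j ≠ l)
    (h0 : Θ (X 0) = X 0 + rename Fin.succ g) (hτ : ∀ i : Fin 4, Θ (X i.succ) = rename Fin.succ (τ (X i)))
    (hτl : τ (X l) = X l) (hτj : τ (X j) = X j) (hτ1 : ∀ i ∈ S' ∩ S, τ (X i) = X i + C (b i) * X j)
    (hτ2 : ∀ k ∈ S' \ S, τ (X k) = X k + C (b k))
    {H Hl : MvPolynomial (Fin 4) K} (hH : coordBlowupSubst K (S : Set (Fin 4)) l H = X l * Hl)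
    (hg : g - τ Hl ∈ Ideal.span (X '' (S' : Set (Fin 4)) : Set (MvPolynomial (Fin 4) K))) :
    (coordStrictTransformIdeal K (insert 0 (Fin.succ '' (S : Set (Fin 4)))) l.succ
      (Ideal.span (insert (X 0 - rename Fin.succ H)
        (((fun k : Fin 4 => (X k.succ - C (b k) : A 4 K)) '' ((S' \ S : Finset (Fin 4)) : Set (Fin 4))) ∪
         ((fun i : Fin 4 => (X i.succ - C (b i) * X j.succ : A 4 K)) '' ((S' ∩ S : Finset (Fin 4)) : Set (Fin 4))))))).map
      (Θ : A 4 K →+* A 4 K) =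
      AffineCoordBlowup.IΛ 4 K (insert 0 (Fin.succ '' (S' : Set (Fin 4)))) := by
  classical
  set Λ : Set (Fin (4 + 1)) := insert 0 (Fin.succ '' (S : Set (Fin 4))) with hΛ
  set Λ' : Set (Fin (4 + 1)) := insert 0 (Fin.succ '' (S' : Set (Fin 4))) with hΛ'
  set gens : Set (A 4 K) := insert (X 0 - rename Fin.succ H)
        (((fun k : Fin 4 => (X k.succ - C (b k) : A 4 K)) '' ((S' \ S : Finset (Fin 4)) : Set (Fin 4))) ∪
         ((fun i : Fin 4 => (X i.succ - C (b i) * X j.succ : A 4 K)) '' ((S' ∩ S : Finset (Fin 4)) : Set (Fin 4))))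
    with hgens
  set sat := coordStrictTransformIdeal K Λ l.succ (Ideal.span gens) with hsat
  have hΘl : Θ (X l.succ) = X l.succ := shear_X_succ_of_eq hτ hτl
  have hprime : (AffineCoordBlowup.IΛ 4 K Λ').IsPrime := AffineCoordBlowup.isPrime_IΛ 4 K Λ'
  have hxl : (X l.succ : A 4 K) ∉ AffineCoordBlowup.IΛ 4 K Λ' := X_succ_not_mem_IΛ hlS'
  -- `Θ ∘ ψ_l` carries every generator of `J_Y` into `(z, x_{S'})`
  have hgen : ∀ f ∈ gens, Θ (coordBlowupSubst K Λ l.succ f) ∈ AffineCoordBlowup.IΛ 4 K Λ' := by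
    intro f hf
    rcases hf with rfl | ⟨k, hk, rfl⟩ | ⟨i, hi, rfl⟩
    · rw [coordBlowupSubst_X_zero_sub_lift hH, map_mul, hΘl, shear_X_zero_sub h0 hτ]
      exact Ideal.mul_mem_left _ _ (Ideal.add_mem _ (Ideal.subset_span ⟨0, Set.mem_insert _ _, rfl⟩)
        (rename_mem_IΛ_of_mem_span hg))
    · obtain ⟨hkS', hkS⟩ := Finset.mem_sdiff.mp (Finset.mem_coe.mp hk)
      rw [coordBlowupSubst_X_sub_C_of_not_mem hkS, shear_X_sub_C hτ (hτ2 k (Finset.mem_sdiff.mpr ⟨hkS', hkS⟩))]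
      exact Ideal.subset_span ⟨k.succ, Set.mem_insert_of_mem _ ⟨k, hkS', rfl⟩, rfl⟩
    · obtain ⟨hiS', hiS⟩ := Finset.mem_inter.mp (Finset.mem_coe.mp hi)
      have hil : i ≠ l := fun e => hlS' (e ▸ hiS')
      rw [coordBlowupSubst_X_sub_C_mul_of_ne hj hjl hiS hil, map_mul, hΘl,
        shear_X_sub_C_mul hτ hτj (hτ1 i (Finset.mem_inter.mpr ⟨hiS', hiS⟩))]
      exact Ideal.mul_mem_left _ _ (Ideal.subset_span ⟨i.succ, Set.mem_insert_of_mem _ ⟨i, hiS', rfl⟩, rfl⟩)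
  have htot : ((Ideal.span gens).map (coordBlowupSubst K Λ l.succ : A 4 K →+* A 4 K)).map (Θ : A 4 K →+* A 4 K) ≤
      AffineCoordBlowup.IΛ 4 K Λ' := by
    rw [Ideal.map_map, Ideal.map_span, Ideal.span_le]
    rintro _ ⟨f, hf, rfl⟩
    exact hgen f hf
  apply le_antisymm
  · -- `Θ(J_Y^{st,l}) ⊆ (z, x_{S'})`: peel off the powers of `x_l` in the prime `(z, x_{S'}) ∌ x_l`
    rw [Ideal.map_le_iff_le_comap]
    rintro f ⟨N, hN⟩
    rw [Ideal.mem_comap]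
    have h1 : (Θ : A 4 K →+* A 4 K) (X l.succ ^ N * f) ∈ AffineCoordBlowup.IΛ 4 K Λ' :=
      htot (Ideal.mem_map_of_mem _ hN)
    rw [map_mul, map_pow, RingHom.coe_coe, hΘl] at h1
    rcases hprime.mem_or_mem h1 with h2 | h2
    · exact absurd (hprime.mem_of_pow_mem N h2) hxl
    · exact h2
  · -- `(z, x_{S'}) ⊆ Θ(J_Y^{st,l})`: the generators `x_k` (`k ∈ S'`) and then `z`
    have hXk : ∀ k ∈ S', (X k.succ : A 4 K) ∈ sat.map (Θ : A 4 K →+* A 4 K) := by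
      intro k hk
      by_cases hkS : k ∈ S
      · have hkl : k ≠ l := fun e => hlS' (e ▸ hk)
        have h1 : (X k.succ - C (b k) * X j.succ : A 4 K) ∈ sat := by
          refine mem_of_X_mul_mem K Λ l.succ ?_
          rw [← coordBlowupSubst_X_sub_C_mul_of_ne hj hjl hkS hkl]
          exact coordBlowupSubst_mem K Λ l.succ (Ideal.subset_span (Set.mem_insert_of_mem _
            (Or.inr ⟨k, Finset.mem_coe.mpr (Finset.mem_inter.mpr ⟨hk, hkS⟩), rfl⟩)))
        have h2 := Ideal.mem_map_of_mem (Θ : A 4 K →+* A 4 K) h1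
        rwa [RingHom.coe_coe, shear_X_sub_C_mul hτ hτj (hτ1 k (Finset.mem_inter.mpr ⟨hk, hkS⟩))] at h2
      · have h1 := coordBlowupSubst_mem K Λ l.succ (I := Ideal.span gens) (Ideal.subset_span
          (Set.mem_insert_of_mem _ (Or.inl ⟨k, Finset.mem_coe.mpr (Finset.mem_sdiff.mpr ⟨hk, hkS⟩), rfl⟩)))
        rw [coordBlowupSubst_X_sub_C_of_not_mem hkS] at h1
        have h2 := Ideal.mem_map_of_mem (Θ : A 4 K →+* A 4 K) h1
        rwa [RingHom.coe_coe, shear_X_sub_C hτ (hτ2 k (Finset.mem_sdiff.mpr ⟨hk, hkS⟩))] at h2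
    have hspan : (Ideal.span (X '' (S' : Set (Fin 4)) : Set (MvPolynomial (Fin 4) K))).map
        (rename Fin.succ : MvPolynomial (Fin 4) K →ₐ[K] A 4 K) ≤ sat.map (Θ : A 4 K →+* A 4 K) := by
      rw [Ideal.map_span, Ideal.span_le]
      rintro _ ⟨_, ⟨k, hk, rfl⟩, rfl⟩
      rw [SetLike.mem_coe, rename_X]
      exact hXk k (Finset.mem_coe.mp hk)
    have hz : (X 0 : A 4 K) ∈ sat.map (Θ : A 4 K →+* A 4 K) := by
      have h1 : X 0 - rename Fin.succ Hl ∈ sat := by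
        refine mem_of_X_mul_mem K Λ l.succ ?_
        rw [← coordBlowupSubst_X_zero_sub_lift hH]
        exact coordBlowupSubst_mem K Λ l.succ (Ideal.subset_span (Set.mem_insert _ _))
      have h2 := Ideal.mem_map_of_mem (Θ : A 4 K →+* A 4 K) h1
      rw [RingHom.coe_coe, shear_X_zero_sub h0 hτ] at h2
      have h3 : rename Fin.succ (g - τ Hl) ∈ sat.map (Θ : A 4 K →+* A 4 K) :=
        hspan (Ideal.mem_map_of_mem _ hg)
      have h5 := Ideal.sub_mem _ h2 h3
      rwa [add_sub_cancel_right] at h5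
    rw [AffineCoordBlowup.IΛ, Ideal.span_le]
    rintro _ ⟨m, hm, rfl⟩
    rcases hm with rfl | ⟨k, hk, rfl⟩
    · exact hz
    · exact hXk k (Finset.mem_coe.mp hk)

/-! ## §4 Cleaning the reading keeps the centre: the cleaning root lies in `(x_{S'})` -/

/-- Deleting `p`-th power monomials does not lower the order along a coordinate subspace (the support shrinks). -/
theorem ordAlong_le_ordAlong_deletePthPowers (q : ℕ) (T : Finset (Fin 4)) (G : MvPolynomial (Fin 4) K) :
    CentreBlowup.ordAlong T G ≤ CentreBlowup.ordAlong T (deletePthPowers q G) := by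
  classical
  refine Finset.le_inf fun d hd => Finset.inf_le ?_
  rw [MvPolynomial.mem_support_iff, coeff_deletePthPowers] at hd
  rw [MvPolynomial.mem_support_iff]
  intro h0
  rw [h0, ite_self] at hd
  exact hd rfl

/-- In characteristic `p`, cleaning does not see an added `p`-th power: `clean(h^p + G) = clean(G)`
(the tree's `deletePthPowers_add_pow_self`, res-idea FrameIndepZ (a)). -/
theorem deletePthPowers_pow_add [hp : Fact p.Prime] [CharP K p] (h G : MvPolynomial (Fin 4) K) :
    deletePthPowers p (h ^ p + G) = deletePthPowers p G := by
  haveI : ExpChar K p := ExpChar.prime hp.out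
  have h1 := Rescue.DecreaseSpec.ResIdea.HP.deletePthPowers_add_pow_self p G h 1
  rwa [pow_one, add_comm G] at h1

/-- **The cleaning root of a permissible reading lies in the ideal of the centre.** Over a perfect field of
characteristic `p`: if `p ≤ ord_{(x_{S'})} G` then there is `h ∈ (x_k : k ∈ S')` with `G + h^p = deletePthPowers p G`
(and the cleaned polynomial is again `S'`-permissible). Reason: `h^p = clean(G) − G ∈ (x_{S'})^p ⊆ (x_{S'})`, a prime. -/
theorem exists_clean_add_pow_mem_span [hp : Fact p.Prime] [CharP K p] [PerfectRing K p] (G : MvPolynomial (Fin 4) K)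
    (hperm : (p : ℕ∞) ≤ CentreBlowup.ordAlong S' G) :
    ∃ h : MvPolynomial (Fin 4) K, h ∈ Ideal.span (X '' (S' : Set (Fin 4)) : Set (MvPolynomial (Fin 4) K)) ∧
      G + h ^ p = deletePthPowers p G ∧ (p : ℕ∞) ≤ CentreBlowup.ordAlong S' (G + h ^ p) := by
  obtain ⟨h, hh⟩ := exists_add_pow_eq_deletePthPowers (p := p) 1 G
  rw [pow_one] at hh
  have hperm1 : (p : ℕ∞) ≤ CentreBlowup.ordAlong S' (deletePthPowers p G) :=
    hperm.trans (ordAlong_le_ordAlong_deletePthPowers p S' G)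
  refine ⟨h, ?_, hh, by rw [hh]; exact hperm1⟩
  have hG := mem_pow_span_X_of_le_ordAlong p S' G hperm
  have hD := mem_pow_span_X_of_le_ordAlong p S' (deletePthPowers p G) hperm1
  have hhp : h ^ p ∈ Ideal.span (X '' (S' : Set (Fin 4)) : Set (MvPolynomial (Fin 4) K)) := by
    refine Ideal.pow_le_self hp.out.ne_zero ?_
    have h1 := Ideal.sub_mem _ hD hG
    rwa [← hh, add_sub_cancel_left] at h1
  exact (isPrime_span_X_image (R := K) (S' : Set (Fin 4))).mem_of_pow_mem p hhp

/-- **The cleaned shear reading.** With `g := g₀ + h`, `h` the cleaning root of the raw reading `G₀ = g₀^p + Q`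
(`Q = τ F'_l`): `g^p + Q = clean(G₀)` is CLEAN, still `S'`-permissible, and `g ≡ g₀ (mod x_{S'})` — so if `g₀ ≡ τ H_l`
then `g ≡ τ H_l`, and §3 applies to the cleaned re-centring as well. -/
theorem exists_clean_shear_root [hp : Fact p.Prime] [CharP K p] [PerfectRing K p] (g₀ Q Hl' : MvPolynomial (Fin 4) K)
    (hg₀ : g₀ - Hl' ∈ Ideal.span (X '' (S' : Set (Fin 4)) : Set (MvPolynomial (Fin 4) K)))
    (hperm : (p : ℕ∞) ≤ CentreBlowup.ordAlong S' (g₀ ^ p + Q)) :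
    ∃ g : MvPolynomial (Fin 4) K, g - Hl' ∈ Ideal.span (X '' (S' : Set (Fin 4)) : Set (MvPolynomial (Fin 4) K)) ∧
      g ^ p + Q = deletePthPowers p (g₀ ^ p + Q) ∧ HauserPerlega.IsClean p (g ^ p + Q) ∧
      (p : ℕ∞) ≤ CentreBlowup.ordAlong S' (g ^ p + Q) := by
  obtain ⟨h, hmem, hh, hperm1⟩ := exists_clean_add_pow_mem_span (S' := S') (g₀ ^ p + Q) hperm
  have hsum : (g₀ + h) ^ p + Q = g₀ ^ p + Q + h ^ p := by rw [add_pow_char]; ring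
  refine ⟨g₀ + h, ?_, ?_, ?_, ?_⟩
  · rw [add_sub_right_comm]
    exact Ideal.add_mem _ hg₀ hmem
  · rw [hsum, hh]
  · rw [hsum, hh]
    exact HauserPerlega.isClean_deletePthPowers p _
  · rw [hsum]
    exact hperm1

end ChartDictionary

end Summit.ResolutionOfSingularities.ResolutionOfSingularities.Theorems.PIDim4

end
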